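import Summits.CriticalPhenomena.CardyFormulaZ2.Theses.CardyRotToConf
import Literature.Probability.RandomPlanarGeometry.SLEArcConfinement
import HarnessLib

/-!
# Stub `stub_sleArcConfinement` of line `germ-label-transport` (crux `stmt-CriticalPhenomena-0698`)

Arc confinement of the SLE_κ trace, `4 < κ < 8` (the regularity of the chordal SLE₆ family used by
the one-shot surgery: no traced straight segments, no traced circle arcs): the registered stub
signature, an instance of the Literature theorem `ae_not_injOn_sleTrace` (`SLEArcConfinement.lean`).
-/

noncomputable section

open Literature.Probability Literature.Probability.RandomPlanarGeometry

namespace Summit.CriticalPhenomena.CardyFormulaZ2.Theorems.CardyRotToConfR2SymmetryUpgrade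

/-- **S7b.** Almost surely, for all `t₁ < t₂`, no continuous real function is injective on the
piece `γ[t₁, t₂]` of the SLE_κ trace, `4 < κ < 8`: no piece of the trace is confined to a simple
arc (line, circle, …). [cite: RohdeSchramm2005, §7] -/
theorem stub_sleArcConfinement : ∀ {κ : NNReal}, 4 < κ → κ < 8 → ∀ᵐ ω ∂Process.preWienerMeasure, ∀ t₁ t₂ : NNReal, t₁ < t₂ → ∀ ρ : ℂ → ℝ, Continuous ρ → ¬ Set.InjOn ρ (sleTrace κ ω '' Set.Icc t₁ t₂) :=
  fun hκ4 hκ8 ↦ ae_not_injOn_sleTrace hκ4 hκ8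

end Summit.CriticalPhenomena.CardyFormulaZ2.Theorems.CardyRotToConfR2SymmetryUpgrade

end
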